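import Summits.ValiantsHypothesis.ValiantsHypothesis.Theorems.GrenetZeonDualUnipotentThreeHalvesHeavyTopCompositionBound

/-!
# `GrenetZeon.DualUnipotentThreeHalves` (stmt-ValiantsHypothesis-24318), R2 `HeavyTopLaw` — instrument kernel row
# «§8 enumerator soundness», LAYER 3d: `HeavyTopInst 6 9` FROM `ι(7) ≤ 17 ∧ ι(8) ≤ 23 ∧ ι(9) ≤ 29`
# (INSTANCES.md v2.2a §8, the `(6,9)` row of the composition-series enumerator, in the kernel)

As in layer 3b (`…HeavyTopCompositionBound.lean :: heavyTopInst_four_six_of_iota`), with `n = 6`, `m = 9`, `n² = 36`: a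
coarsening cut with `2 ≤ #{lvl < t} ≤ 7` costs `2·6 + C(a,2) + C(9−a,2) ≤ 34 < 36` by Gerstenhaber (✓
`flagCheap_of_invariant_levels`); otherwise every cut lies in `{0,1,8,9}`, so the level sizes are `(9)`, `(1,8)`, `(8,1)` or
`(1,7,1)`, the big block is an IRREDUCIBLE nilpotent space of `M_9`, `M_8` or `M_7`, and ✓ `flagCheap_of_block_dims` costs
`6 + 29`, `12 + 23`, `12 + 23`, `18 + 17`, all `= 35 < 36`.

* `heavyTopInst_six_nine_of_iota (hι7) (hι8) (hι9) : HeavyTopInst 6 9`.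

HONEST LABEL: a CONDITIONAL instance row — the three `ι`-bounds are OPEN finite questions (print offers only MOR 1991's lower
bound `ι(3k) ≥ k² + 1`, so `ι(9) ≥ 10`); nothing here proves `HeavyTopInst 6 9` outright, nor `HeavyTopLaw`, 24318, S3b;
`VP ≠ VNP` is NOT proved; no summit statement is proved here.  No definitions, no named facts.
(Desk RULING #299 (a); instance table val-port-3 g2; critic of record val-idea-crit-3 g4.)  [folklore bookkeeping]
-/

noncomputable section

-- single-conjunct layout: Sub = Summit, duplicated namespace component intended
set_option linter.dupNamespace false

namespace Summit.ValiantsHypothesis.ValiantsHypothesis.Theorems.GrenetZeon.HeavyTopCompositionBound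

open MvPolynomial Matrix
open scoped BigOperators
open Summit.ValiantsHypothesis.ValiantsHypothesis.Cruxes.TwoDimCoefficients.DimTwoCases (AffMat IsAffine)
open Summit.ValiantsHypothesis.ValiantsHypothesis.Theorems.GrenetZeon.RadicalSplit
open Summit.ValiantsHypothesis.ValiantsHypothesis.Theorems.GrenetZeon.HeavyTopInvariantFlag (flagCheap_of_invariant_levels)
open Literature.LinearAlgebra.Matrix.GerstenhaberNilpotentSubspace (finrank_le_choose_two)

/-! ## `HeavyTopInst 6 9` from `ι(7) ≤ 17`, `ι(8) ≤ 23`, `ι(9) ≤ 29` -/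

set_option maxHeartbeats 1600000 in
/-- **`ι(7) ≤ 17 ∧ ι(8) ≤ 23 ∧ ι(9) ≤ 29 ⟹ HeavyTopInst 6 9`** (INSTANCES.md v2.2a §8, kernel form; the `ι`-bounds are
HYPOTHESES on irreducible nilpotent subspaces of `M_7(ℂ)`, `M_8(ℂ)`, `M_9(ℂ)`).  Conditional instance row; NOT a proof of
`HeavyTopInst 6 9`, `HeavyTopLaw` or 24318. [folklore bookkeeping over Theorem G] -/
theorem heavyTopInst_six_nine_of_iota
    (hι7 : ∀ V : Submodule ℂ (Matrix (Fin 7) (Fin 7) ℂ), (∀ A ∈ V, IsNilpotent A) →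
      (∀ U : Submodule ℂ (Fin 7 → ℂ), (∀ A ∈ V, ∀ x ∈ U, A *ᵥ x ∈ U) → U = ⊥ ∨ U = ⊤) →
      Module.finrank ℂ V ≤ 17)
    (hι8 : ∀ V : Submodule ℂ (Matrix (Fin 8) (Fin 8) ℂ), (∀ A ∈ V, IsNilpotent A) →
      (∀ U : Submodule ℂ (Fin 8 → ℂ), (∀ A ∈ V, ∀ x ∈ U, A *ᵥ x ∈ U) → U = ⊥ ∨ U = ⊤) →
      Module.finrank ℂ V ≤ 23)
    (hι9 : ∀ V : Submodule ℂ (Matrix (Fin 9) (Fin 9) ℂ), (∀ A ∈ V, IsNilpotent A) →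
      (∀ U : Submodule ℂ (Fin 9 → ℂ), (∀ A ∈ V, ∀ x ∈ U, A *ᵥ x ∈ U) → U = ⊥ ∨ U = ⊤) →
      Module.finrank ℂ V ≤ 29) :
    HeavyTopInst 6 9 := by
  classical
  intro N hN hnil _
  -- the nilpotent space `W = ℂ·N(0) + N_lin` and its composition chain in matrix clothes
  obtain ⟨T, hT⟩ := exists_topMap_linPart N hN
  obtain ⟨P, L, lvl, hlvl, _hLm, hne, hblk, hirr⟩ :=
    exists_block_conj (((ℂ ∙ N.map (MvPolynomial.eval 0)) ⊔ LinearMap.range T : Submodule ℂ (Matrix (Fin 9) (Fin 9) ℂ)) :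
      Set (Matrix (Fin 9) (Fin 9) ℂ))
  have hPW : ∀ A ∈ (ℂ ∙ N.map (MvPolynomial.eval 0)) ⊔ LinearMap.range T, ∀ i j : Fin 9, lvl i < lvl j →
      ((P : Matrix (Fin 9) (Fin 9) ℂ) * A * (↑P⁻¹ : Matrix (Fin 9) (Fin 9) ℂ)) i j = 0 := fun A hA => hblk A hA
  have hpoly := pencil_blockUpper_of_forall_mem N T hT P lvl hPW
  -- Gerstenhaber and the irreducible bounds, per block
  have hGer : ∀ (s : ℕ) (V : Submodule ℂ (Matrix (Fin s) (Fin s) ℂ)), (∀ B ∈ V, IsNilpotent B) →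
      (∀ U : Submodule ℂ (Fin s → ℂ), (∀ B ∈ V, ∀ x ∈ U, B *ᵥ x ∈ U) → U = ⊥ ∨ U = ⊤) →
      Module.finrank ℂ V ≤ s.choose 2 := fun s V hV _ => finrank_le_choose_two s V hV
  have hbound : ∀ (t : ℕ), t < L → ∀ (s : ℕ) (e : {i : Fin 9 // lvl i = t} ≃ Fin s) (β : ℕ),
      (∀ V : Submodule ℂ (Matrix (Fin s) (Fin s) ℂ), (∀ B ∈ V, IsNilpotent B) →
        (∀ U : Submodule ℂ (Fin s → ℂ), (∀ B ∈ V, ∀ x ∈ U, B *ᵥ x ∈ U) → U = ⊥ ∨ U = ⊤) →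
        Module.finrank ℂ V ≤ β) →
      Module.finrank ℂ (Submodule.span ℂ (Set.range fun v : Fin 6 × Fin 6 → ℂ =>
        Matrix.reindex e e (((P : Matrix (Fin 9) (Fin 9) ℂ) * linPart N v * (↑P⁻¹ : Matrix (Fin 9) (Fin 9) ℂ)).toBlock
          (fun i => lvl i = t) (fun i => lvl i = t)))) ≤ β :=
    fun t ht s e β hβ => finrank_blockSpan_le N hN hnil T hT P lvl hPW t e β hβ (hirr t ht s e)
  -- the cut profile
  have hcut0 : (Finset.univ.filter (fun i : Fin 9 => lvl i < 0)).card = 0 := by simp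
  have hcutL : ∀ t, L ≤ t → (Finset.univ.filter (fun i : Fin 9 => lvl i < t)).card = 9 := cut_eq_card lvl hlvl
  have hstep : ∀ t, t < L → (Finset.univ.filter (fun i : Fin 9 => lvl i < t)).card <
      (Finset.univ.filter (fun i : Fin 9 => lvl i < t + 1)).card := by
    intro t ht; rw [cut_succ]; have := hne t ht; omega
  have hL1 : 1 ≤ L := Nat.succ_le_of_lt (Nat.lt_of_le_of_lt (Nat.zero_le _) (hlvl 0))
  by_cases hA : ∃ t, 2 ≤ (Finset.univ.filter (fun i : Fin 9 => lvl i < t)).card ∧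
      (Finset.univ.filter (fun i : Fin 9 => lvl i < t)).card ≤ 7
  · -- COARSEN at the cut `t`: two levels, Gerstenhaber
    obtain ⟨t, h2, h7⟩ := hA
    let lvl' : Fin 9 → ℕ := fun i => if lvl i < t then 0 else 1
    have hlvl' : ∀ i, lvl' i < 2 := fun i => by dsimp only [lvl']; split_ifs <;> norm_num
    have hblock' : ∀ i j : Fin 9, lvl' i < lvl' j →
        ((P : Matrix (Fin 9) (Fin 9) ℂ).map C * N * (↑P⁻¹ : Matrix (Fin 9) (Fin 9) ℂ).map C :
          Matrix (Fin 9) (Fin 9) (MvPolynomial (Fin 6 × Fin 6) ℂ)) i j = 0 := by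
      intro i j hij
      apply hpoly i j
      dsimp only [lvl'] at hij
      split_ifs at hij with hi hj <;> omega
    have hc0 : Fintype.card {i : Fin 9 // lvl' i = 0} = (Finset.univ.filter (fun i : Fin 9 => lvl i < t)).card := by
      rw [Fintype.card_subtype]; congr 1; ext i; simp [lvl']
    have hc1 : Fintype.card {i : Fin 9 // lvl' i = 1} = 9 - (Finset.univ.filter (fun i : Fin 9 => lvl i < t)).card := by
      rw [Fintype.card_subtype]
      have h := Finset.card_filter_add_card_filter_not (s := (Finset.univ : Finset (Fin 9))) (fun i => lvl i < t)
      rw [Finset.card_univ, Fintype.card_fin] at h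
      have h' : (Finset.univ.filter (fun i : Fin 9 => lvl' i = 1)) = Finset.univ.filter (fun i => ¬ lvl i < t) := by
        ext i; simp [lvl']
      rw [h']; omega
    refine flagCheap_of_invariant_levels N hN hnil P lvl' 2 (by norm_num) hlvl' hblock' ?_
    rw [Finset.sum_range_succ, Finset.sum_range_succ, Finset.sum_range_zero, zero_add, hc0, hc1]
    set x := (Finset.univ.filter (fun i : Fin 9 => lvl i < t)).card with hx
    interval_cases x <;> decide
  · -- every cut is `≤ 1` or `≥ 8`: the composition is `(9)`, `(1,8)`, `(8,1)` or `(1,7,1)`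
    obtain ⟨a, ha⟩ : ∃ a : ℕ → ℕ, ∀ t, a t = (Finset.univ.filter (fun i : Fin 9 => lvl i < t)).card :=
      ⟨_, fun _ => rfl⟩
    have ha0 : a 0 = 0 := by rw [ha]; simp
    have haL : ∀ t, L ≤ t → a t = 9 := fun t ht => by rw [ha]; exact hcutL t ht
    have hst : ∀ t, t < L → a t < a (t + 1) := fun t ht => by rw [ha, ha]; exact hstep t ht
    have hsize : ∀ t, (Finset.univ.filter (fun i : Fin 9 => lvl i = t)).card = a (t + 1) - a t := by
      intro t; rw [ha, ha, cut_succ]; omega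
    have hB : ∀ t, a t ≤ 1 ∨ 8 ≤ a t := by
      intro t
      by_contra h
      push Not at h
      exact hA ⟨t, by rw [← ha]; omega, by rw [← ha]; omega⟩
    have h1 : a 0 < a 1 := hst 0 (by omega)
    have hB1 := hB 1
    have hB2 := hB 2
    have hB3 := hB 3
    -- how many levels?
    rcases Nat.lt_or_ge L 4 with hL4 | hL4
    swap
    · -- `L ≥ 4` is impossible
      exfalso
      have h2 : a 1 < a 2 := hst 1 (by omega)
      have h3 : a 2 < a 3 := hst 2 (by omega)
      have h4 : a 3 < a 4 := hst 3 (by omega)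
      have h6 : a 4 ≤ 9 := by
        rw [ha]
        calc _ ≤ (Finset.univ : Finset (Fin 9)).card := Finset.card_filter_le _ _
          _ = 9 := by simp
      omega
    interval_cases L
    · -- one level: the whole space is IRREDUCIBLE for `W`, size 9
      have hs0 : (Finset.univ.filter (fun i : Fin 9 => lvl i = 0)).card = 9 := by
        rw [hsize, haL 1 le_rfl, ha0]
      obtain ⟨e0⟩ := exists_level_equiv lvl 0 9 hs0
      refine flagCheap_of_block_dims N hN P lvl 1 le_rfl hlvl hpoly (fun _ => 29) (fun t => ?_) (by decide)
      fin_cases t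
      exact ⟨9, e0, hbound 0 (by omega) 9 e0 29 hι9⟩
    · -- two levels: `(1,8)` or `(8,1)`
      have hc2 : a 2 = 9 := haL 2 le_rfl
      have h2 : a 1 < a 2 := hst 1 (by omega)
      have hs0 : (Finset.univ.filter (fun i : Fin 9 => lvl i = 0)).card = a 1 - a 0 := hsize 0
      have hs1 : (Finset.univ.filter (fun i : Fin 9 => lvl i = 1)).card = a 2 - a 1 := hsize 1
      rcases hB1 with hlo | hhi
      · -- `(1,8)`
        rw [ha0] at hs0
        have hs0' : (Finset.univ.filter (fun i : Fin 9 => lvl i = 0)).card = 1 := by rw [hs0]; omega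
        have hs1' : (Finset.univ.filter (fun i : Fin 9 => lvl i = 1)).card = 8 := by rw [hs1]; omega
        obtain ⟨e0⟩ := exists_level_equiv lvl 0 1 hs0'
        obtain ⟨e1⟩ := exists_level_equiv lvl 1 8 hs1'
        refine flagCheap_of_block_dims N hN P lvl 2 (by norm_num) hlvl hpoly (fun t => if t = 0 then 0 else 23)
          (fun t => ?_) (by decide)
        fin_cases t
        · exact ⟨1, e0, (hbound 0 (by omega) 1 e0 (Nat.choose 1 2) (hGer 1)).trans (by decide)⟩
        · exact ⟨8, e1, hbound 1 (by omega) 8 e1 23 hι8⟩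
      · -- `(8,1)`
        rw [ha0] at hs0
        have hs0' : (Finset.univ.filter (fun i : Fin 9 => lvl i = 0)).card = 8 := by rw [hs0]; omega
        have hs1' : (Finset.univ.filter (fun i : Fin 9 => lvl i = 1)).card = 1 := by rw [hs1]; omega
        obtain ⟨e0⟩ := exists_level_equiv lvl 0 8 hs0'
        obtain ⟨e1⟩ := exists_level_equiv lvl 1 1 hs1'
        refine flagCheap_of_block_dims N hN P lvl 2 (by norm_num) hlvl hpoly (fun t => if t = 0 then 23 else 0)
          (fun t => ?_) (by decide)
        fin_cases t
        · exact ⟨8, e0, hbound 0 (by omega) 8 e0 23 hι8⟩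
        · exact ⟨1, e1, (hbound 1 (by omega) 1 e1 (Nat.choose 1 2) (hGer 1)).trans (by decide)⟩
    · -- three levels: `(1,7,1)`
      have h2 : a 1 < a 2 := hst 1 (by omega)
      have h3 : a 2 < a 3 := hst 2 (by omega)
      have hc3 : a 3 = 9 := haL 3 le_rfl
      have hs0 : (Finset.univ.filter (fun i : Fin 9 => lvl i = 0)).card = 1 := by
        have h : (Finset.univ.filter (fun i : Fin 9 => lvl i = 0)).card = a 1 - a 0 := hsize 0
        rw [h, ha0]; omega
      have hs1 : (Finset.univ.filter (fun i : Fin 9 => lvl i = 1)).card = 7 := by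
        have h : (Finset.univ.filter (fun i : Fin 9 => lvl i = 1)).card = a 2 - a 1 := hsize 1
        rw [h]; omega
      have hs2 : (Finset.univ.filter (fun i : Fin 9 => lvl i = 2)).card = 1 := by
        have h : (Finset.univ.filter (fun i : Fin 9 => lvl i = 2)).card = a 3 - a 2 := hsize 2
        rw [h]; omega
      obtain ⟨e0⟩ := exists_level_equiv lvl 0 1 hs0
      obtain ⟨e1⟩ := exists_level_equiv lvl 1 7 hs1
      obtain ⟨e2⟩ := exists_level_equiv lvl 2 1 hs2
      refine flagCheap_of_block_dims N hN P lvl 3 (by norm_num) hlvl hpoly (fun t => if t = 1 then 17 else 0)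
        (fun t => ?_) (by decide)
      fin_cases t
      · exact ⟨1, e0, (hbound 0 (by omega) 1 e0 (Nat.choose 1 2) (hGer 1)).trans (by decide)⟩
      · exact ⟨7, e1, hbound 1 (by omega) 7 e1 17 hι7⟩
      · exact ⟨1, e2, (hbound 2 (by omega) 1 e2 (Nat.choose 1 2) (hGer 1)).trans (by decide)⟩

end Summit.ValiantsHypothesis.ValiantsHypothesis.Theorems.GrenetZeon.HeavyTopCompositionBound

end
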